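import Literature.NumberTheory.LFunctions.GaussianHeckeColemanZFR
import Literature.NumberTheory.LFunctions.GaussianPrimesHarmanProofs
import Literature.NumberTheory.LFunctions.GaussianLinePhase
import HarnessLib

/-!
# From the lines `Im z = b` to the lattice: Coleman's Theorem 1 for `ℤ[i]`, the Coleman zero-free region and
# Harman's Lemma 11.6 from a Vinogradov–Korobov bound for the LINE sums `∑_a λ^m(a + bi) N(a + bi)^{-it}`

Topic `Literature/NumberTheory/LFunctions`.  This file introduces the line-segment sums
`GaussLine.lineSum m t b A₁ A₂ = ∑_{A₁ ≤ a ≤ A₂} λ^m(a + bi) N(a + bi)^{-it}` (the left side of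
`GaussLine.norm_lineSum_le_shift`, `GaussianLinePhase.lean`), ONE parametrised HYPOTHESIS — the predicate
`GaussLine.LineSumBound C D` (in the spirit of the tree's `ExpSumBound C D`, `GaussianHecke.LatticeExpSumBound C D`;
NOT a named fact) — three bookkeeping finsets (`annulus`, `halfAnnulus`, `diagAnnulus`) and the rotation `rot z = iz`,
and PROVES the purely combinatorial passage from lines to annuli:

* `latticeExpSumBound_of_lineSumBound` — **`LineSumBound C D ⟹ LatticeExpSumBound (24C + 54) (max(64D, 32))`**:
  if for all `m ≥ 1`, real `t`, `b ≠ 0`, `-|b| ≤ A₁`, `A₂ ≤ |b|`, `b² ≤ 2V⁴` (`V = m + |t| + 3`)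
  `‖∑_{A₁ ≤ a ≤ A₂} λ^m(a + bi) N(a + bi)^{-it}‖ ≤ C |b|^{1 − log²|b|/(D log²V)}`, then for all `m ≥ 1`,
  `1 ≤ M ≤ u ≤ 2M`, `M ≤ V⁴`: `‖∑_{M < N z ≤ u} λ^m(z) N(z)^{-it}‖ ≤ C' M^{1 − log²M/(D' log²V)}` — the hypothesis
  of `GaussianHecke.exists_richert_of_latticeExpSumBound` (the shape of M. D. Coleman's Theorem 1, Mathematika 37
  (1990), for `K = ℚ(i)`);
* `exists_hasVKZeroFreeRegion_of_lineSumBound` — hence (`GaussianHeckeColemanZFR.lean`) Coleman's zero-free region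
  `∃ c > 0, GaussianHecke.HasVKZeroFreeRegion c 21` for the Hecke `L`-functions `L(s, λ^m)` of `ℚ(i)`;
* `harman_primeCharSum_bound_of_lineSumBound` — and (`GaussianPrimesHarmanProofs.lean`) the named fact
  `Literature.NumberTheory.LFunctions.GaussianInt.harman_primeCharSum_bound` (Harman, *Prime-Detecting Sieves*,
  Lemma 11.6).

So the one remaining input of Harman's Lemma 11.6 in the tree is `∃ C ≥ 0, D > 0, LineSumBound C D`: the
`ℚ(i)`-analogue of Vinogradov's zeta-sum estimate along a line of the lattice (Vinogradov's range `|b|^{K+1/2} ≤ V` by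
Korobov–Vinogradov, `GaussianLinePhase.lean`, `GaussianLineGoodIndex.lean`, …; the range of bounded
`λ = log V/log |b|` by van der Corput's `k`-th derivative tests, as in `ExpSumBoundReduction.lean`).

## The argument

The summand `Φ(z) = λ^m(z) N(z)^{-it}` is invariant under the rotation `z ↦ iz` (`i^{4m} = 1`), which maps the part
`|im z| < |re z|` of the annulus `M < N(z) ≤ u` onto the part `|re z| < |im z|`; so
`∑_{annulus} Φ = 2 ∑_{|re z| < |im z|} Φ + ∑_{|re z| = |im z|} Φ` (`sum_annulus_eq`), the diagonal having at most
`2(2⌊√u⌋ + 1)` points.  The strict half is fibred by `b = im z ∈ [-⌊√u⌋, ⌊√u⌋]`; on the line `Im z = b` its points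
with `a = re z ≥ 0` (resp. `a < 0`) form an integer interval (`a ↦ a²` is monotone there) contained in `(-|b|, |b|)`,
and such a line carries points only if `M < a² + b² < 2b²`, `b² ≤ u ≤ 2M` (`norm_sum_line_le`).  Hence
`‖∑_{annulus} Φ‖ ≤ 2 (2⌊√u⌋ + 1) · 2 C √(2M) e^{−(½ log(M/2))³/(D log²V)} + 2(2⌊√u⌋ + 1)`, and for `M ≥ 4`
(`log 2 ≤ ½ log M`) `(½ log(M/2))³ ≥ log³M/64`, `2⌊√u⌋ + 1 ≤ 3√(2M)`, `6√(2M) ≤ 9√M ≤ 9 M^{1 − E}`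
(`E = log²M/(D' log²V) ≤ 16/D' ≤ 1/2` as `M ≤ V⁴`); for `M ≤ 3` the trivial bound `#{N z ≤ u} ≤ 9u ≤ 54` suffices.

## References

* M. D. Coleman, *A zero-free region for the Hecke L-functions*, Mathematika 37 (1990), 287–304, Theorems 1, 2.
  [cite: ColemanMathematika1990, Theorem 1]
* G. Harman, *Prime-Detecting Sieves*, Princeton UP 2007, §11.4, Lemma 11.6 p. 206 (the consumer).
  [cite: Harman2007, Lemma 11.6]
* A. Ivić, *The Riemann Zeta-Function*, Wiley 1985, §6.3 (the one-dimensional model). [cite: Ivic1985, Theorem 6.2]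
-/

noncomputable section

open Complex Finset Real

namespace Literature.NumberTheory.LFunctions

namespace GaussLine

open GaussianInt (angularChar angularChar_def norm_angularChar normLE mem_normLE)
open GaussianHecke (latticeBlockSum LatticeExpSumBound)

/-! ### The line sums and the hypothesis -/

/-- The line-segment sum `∑_{A₁ ≤ a ≤ A₂} λ^m(a + bi) N(a + bi)^{-it}` along `Im z = b`
(the left side of `GaussLine.norm_lineSum_le_shift`). [cite: ColemanMathematika1990, Theorem 1] -/
def lineSum (m : ℕ) (t : ℝ) (b A₁ A₂ : ℤ) : ℂ :=
  ∑ a ∈ Icc A₁ A₂, angularChar m ⟨a, b⟩ * (((((⟨a, b⟩ : GaussianInt).norm : ℝ)) : ℂ) ^ (-(t * I)))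

/-- **A Vinogradov–Korobov bound for the line sums, as a predicate** in the constants `(C, D)`: for all
`m ≥ 1`, real `t`, `b ≠ 0`, `-|b| ≤ A₁`, `A₂ ≤ |b|` and `b² ≤ 2V⁴`, `V = m + |t| + 3`,
`‖∑_{A₁ ≤ a ≤ A₂} λ^m(a + bi) N(a + bi)^{-it}‖ ≤ C |b|^{1 − (log |b|)²/(D (log V)²)}` (Coleman's Theorem 1 for
`K = ℚ(i)` restricted to a line of the lattice, in Ford's normalisation; a DEFINITION, the hypothesis of
`latticeExpSumBound_of_lineSumBound` — not asserted here). [cite: ColemanMathematika1990, Theorem 1] -/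
def LineSumBound (C D : ℝ) : Prop :=
  ∀ (m : ℕ) (t : ℝ) (b A₁ A₂ : ℤ), 1 ≤ m → b ≠ 0 → -|b| ≤ A₁ → A₂ ≤ |b| →
    ((b : ℝ)) ^ 2 ≤ 2 * ((m : ℝ) + |t| + 3) ^ 4 →
      ‖lineSum m t b A₁ A₂‖ ≤
        C * |(b : ℝ)| ^ (1 - Real.log |(b : ℝ)| ^ 2 / (D * Real.log ((m : ℝ) + |t| + 3) ^ 2))

/-! ### Integer intervals -/

/-- A nonempty order-convex finite set of integers is the interval between its extremes. [folklore] -/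
theorem eq_Icc_of_ordConnected {s : Finset ℤ} (hs : s.Nonempty)
    (hconv : ∀ x ∈ s, ∀ y ∈ s, ∀ z : ℤ, x ≤ z → z ≤ y → z ∈ s) :
    s = Icc (s.min' hs) (s.max' hs) := by
  ext z
  constructor
  · intro hz
    exact mem_Icc.mpr ⟨s.min'_le z hz, s.le_max' z hz⟩
  · intro hz
    rw [mem_Icc] at hz
    exact hconv _ (s.min'_mem hs) _ (s.max'_mem hs) z hz.1 hz.2

/-! ### The summand `Φ(z) = λ^m(z) N(z)^{-it}` and the rotation `z ↦ iz` -/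

/-- The rotation `z ↦ iz = ⟨-im z, re z⟩` of `ℤ[i]`. [folklore] -/
def rot (z : GaussianInt) : GaussianInt := ⟨-z.im, z.re⟩

/-- `rot z = i · z` in `ℂ`. [folklore] -/
theorem rot_coe (z : GaussianInt) : ((rot z : GaussianInt) : ℂ) = I * (z : ℂ) := by
  rw [rot, GaussianInt.toComplex_def', GaussianInt.toComplex_def z]
  push_cast
  ring_nf
  rw [I_sq]
  ring

/-- `N(iz) = N(z)`. [folklore] -/
theorem norm_rot (z : GaussianInt) : (rot z).norm = z.norm := by
  simp [rot, Zsqrtd.norm_def]; ring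

/-- `z ↦ iz` is injective. [folklore] -/
theorem rot_injective : Function.Injective rot := by
  intro z w h
  have h1 := congrArg Zsqrtd.re h
  have h2 := congrArg Zsqrtd.im h
  simp only [rot] at h1 h2
  ext <;> omega

/-- `λ^m(iz) = λ^m(z)` (`i^{4m} = 1`). [folklore] -/
theorem angularChar_rot (m : ℕ) (z : GaussianInt) : angularChar m (rot z) = angularChar m z := by
  rw [angularChar_def, angularChar_def, rot_coe, norm_mul, Complex.norm_I, one_mul, mul_div_assoc, mul_pow,
    pow_mul, I_pow_four, one_pow, one_mul]

/-- `Φ(iz) = Φ(z)`. [folklore] -/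
theorem phase_rot (m : ℕ) (t : ℝ) (z : GaussianInt) :
    angularChar m (rot z) * ((((rot z).norm : ℝ)) : ℂ) ^ (-(t * I)) =
      angularChar m z * (((z.norm : ℝ)) : ℂ) ^ (-(t * I)) := by
  rw [angularChar_rot, norm_rot]

/-- `‖Φ(z)‖ ≤ 1` for every `z` (`= 1` for `z ≠ 0`; at `z = 0`, `λ^m(0) = 0` for `m ≥ 1` and `= 1` for `m = 0`).
[folklore] -/
theorem norm_phase_le_one (m : ℕ) (t : ℝ) (z : GaussianInt) :
    ‖angularChar m z * (((z.norm : ℝ)) : ℂ) ^ (-(t * I))‖ ≤ 1 := by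
  rcases eq_or_ne z 0 with rfl | hz
  · rw [norm_mul]
    have h1 : ‖angularChar m (0 : GaussianInt)‖ ≤ 1 := by
      rw [angularChar_def]
      simp only [map_zero, norm_zero, Complex.ofReal_zero, div_zero]
      rcases Nat.eq_zero_or_pos m with rfl | hm
      · simp
      · rw [zero_pow (by omega)]; simp
    have h2 : ‖((((0 : GaussianInt).norm : ℝ)) : ℂ) ^ (-(t * I))‖ ≤ 1 := by
      rw [Zsqrtd.norm_zero]
      push_cast
      rcases eq_or_ne (-(t * I) : ℂ) 0 with h0 | h0
      · rw [h0, cpow_zero]; simp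
      · rw [zero_cpow h0]; simp
    calc ‖angularChar m 0‖ * ‖((((0 : GaussianInt).norm : ℝ)) : ℂ) ^ (-(t * I))‖ ≤ 1 * 1 :=
          mul_le_mul h1 h2 (norm_nonneg _) zero_le_one
      _ = 1 := one_mul _
  · exact (norm_phase_eq_one m t hz).le

/-! ### The annulus `M < N(z) ≤ u`, its strict half `|re z| < |im z|` and its diagonal -/

/-- `N(a + bi) = a² + b²`. [folklore] -/
theorem norm_mk (a b : ℤ) : (⟨a, b⟩ : GaussianInt).norm = a ^ 2 + b ^ 2 := by
  rw [Zsqrtd.norm_def]; ring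

/-- The annulus `{z : M < N(z) ≤ u}` (the range of `GaussianHecke.latticeBlockSum`). [folklore] -/
def annulus (M u : ℕ) : Finset GaussianInt := (normLE (u : ℝ)).filter fun z ↦ (M : ℤ) < z.norm

/-- Its strict northern/southern half `|re z| < |im z|`. [folklore] -/
def halfAnnulus (M u : ℕ) : Finset GaussianInt := (annulus M u).filter fun z ↦ |z.re| < |z.im|

/-- Its diagonal part `|re z| = |im z|`. [folklore] -/
def diagAnnulus (M u : ℕ) : Finset GaussianInt := (annulus M u).filter fun z ↦ |z.re| = |z.im|

/-- Membership in the annulus. [folklore] -/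
theorem mem_annulus {M u : ℕ} {z : GaussianInt} : z ∈ annulus M u ↔ z.norm ≤ u ∧ (M : ℤ) < z.norm := by
  rw [annulus, mem_filter, mem_normLE]
  constructor
  · rintro ⟨h1, h2⟩; exact ⟨by exact_mod_cast h1, h2⟩
  · rintro ⟨h1, h2⟩; exact ⟨by exact_mod_cast h1, h2⟩

/-- Membership in the strict half. [folklore] -/
theorem mem_halfAnnulus {M u : ℕ} {z : GaussianInt} :
    z ∈ halfAnnulus M u ↔ (z.norm ≤ u ∧ (M : ℤ) < z.norm) ∧ |z.re| < |z.im| := by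
  rw [halfAnnulus, mem_filter, mem_annulus]

/-- Membership of `⟨a, b⟩` in the strict half. [folklore] -/
theorem mem_halfAnnulus_mk {M u : ℕ} {a b : ℤ} :
    (⟨a, b⟩ : GaussianInt) ∈ halfAnnulus M u ↔ (a ^ 2 + b ^ 2 ≤ u ∧ (M : ℤ) < a ^ 2 + b ^ 2) ∧ |a| < |b| := by
  rw [mem_halfAnnulus, norm_mk]

/-- `latticeBlockSum` is the sum of `Φ` over the annulus. [folklore] -/
theorem latticeBlockSum_eq (m : ℕ) (t : ℝ) (M u : ℕ) :
    latticeBlockSum m t M u = ∑ z ∈ annulus M u, angularChar m z * (((z.norm : ℝ)) : ℂ) ^ (-(t * I)) := rfl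

/-- `|re z|, |im z| ≤ ⌊√u⌋` on the annulus. [folklore] -/
theorem abs_re_im_le_sqrt {M u : ℕ} {z : GaussianInt} (hz : z ∈ annulus M u) :
    |z.re| ≤ (Nat.sqrt u : ℤ) ∧ |z.im| ≤ (Nat.sqrt u : ℤ) := by
  rw [mem_annulus] at hz
  obtain ⟨hu, -⟩ := hz
  rw [Zsqrtd.norm_def] at hu
  have hre : z.re.natAbs ≤ Nat.sqrt u := by
    rw [Nat.le_sqrt]
    have h1 : ((z.re.natAbs * z.re.natAbs : ℕ) : ℤ) ≤ u := by
      rw [Int.natAbs_mul_self]; nlinarith [mul_self_nonneg z.im]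
    exact_mod_cast h1
  have him : z.im.natAbs ≤ Nat.sqrt u := by
    rw [Nat.le_sqrt]
    have h1 : ((z.im.natAbs * z.im.natAbs : ℕ) : ℤ) ≤ u := by
      rw [Int.natAbs_mul_self]; nlinarith [mul_self_nonneg z.re]
    exact_mod_cast h1
  constructor
  · rw [← Int.natCast_natAbs]; exact_mod_cast hre
  · rw [← Int.natCast_natAbs]; exact_mod_cast him

/-- The annulus is the disjoint union of the strict half, its rotation, and the diagonal:
`∑_{annulus} Φ = 2 ∑_{half} Φ + ∑_{diag} Φ` for the rotation-invariant summand `Φ`. [folklore] -/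
theorem sum_annulus_eq (m : ℕ) (t : ℝ) (M u : ℕ) :
    ∑ z ∈ annulus M u, angularChar m z * (((z.norm : ℝ)) : ℂ) ^ (-(t * I)) =
      2 * ∑ z ∈ halfAnnulus M u, angularChar m z * (((z.norm : ℝ)) : ℂ) ^ (-(t * I)) +
        ∑ z ∈ diagAnnulus M u, angularChar m z * (((z.norm : ℝ)) : ℂ) ^ (-(t * I)) := by
  classical
  set f : GaussianInt → ℂ := fun z ↦ angularChar m z * (((z.norm : ℝ)) : ℂ) ^ (-(t * I)) with hf
  set S₂ := (annulus M u).filter fun z ↦ |z.im| < |z.re| with hS₂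
  -- the partition
  have hunion : annulus M u = halfAnnulus M u ∪ S₂ ∪ diagAnnulus M u := by
    ext z
    simp only [hS₂, halfAnnulus, diagAnnulus, mem_union, mem_filter]
    constructor
    · intro hz
      rcases lt_trichotomy |z.re| |z.im| with h | h | h
      · exact Or.inl (Or.inl ⟨hz, h⟩)
      · exact Or.inr ⟨hz, h⟩
      · exact Or.inl (Or.inr ⟨hz, h⟩)
    · rintro ((⟨hz, -⟩ | ⟨hz, -⟩) | ⟨hz, -⟩) <;> exact hz
  have hd12 : Disjoint (halfAnnulus M u) S₂ := by
    rw [hS₂, halfAnnulus, disjoint_filter]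
    intro z _ h1 h2
    exact lt_asymm h1 h2
  have hd3 : Disjoint (halfAnnulus M u ∪ S₂) (diagAnnulus M u) := by
    rw [disjoint_union_left, hS₂, halfAnnulus, diagAnnulus, disjoint_filter, disjoint_filter]
    exact ⟨fun z _ h1 h2 ↦ absurd h2 h1.ne, fun z _ h1 h2 ↦ absurd h2.symm h1.ne⟩
  -- the rotation maps `S₂` onto the strict half
  have hrot : S₂.image rot = halfAnnulus M u := by
    ext z
    simp only [mem_image, hS₂, mem_filter, halfAnnulus, mem_annulus]
    constructor
    · rintro ⟨w, ⟨⟨hw1, hw2⟩, hw3⟩, rfl⟩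
      refine ⟨⟨by rw [norm_rot]; exact hw1, by rw [norm_rot]; exact hw2⟩, ?_⟩
      simpa [rot] using hw3
    · rintro ⟨⟨hz1, hz2⟩, hz3⟩
      refine ⟨⟨z.im, -z.re⟩, ⟨⟨?_, ?_⟩, ?_⟩, ?_⟩
      · rw [norm_mk]; rw [Zsqrtd.norm_def] at hz1; nlinarith
      · rw [norm_mk]; rw [Zsqrtd.norm_def] at hz2; nlinarith
      · simpa using hz3
      · ext <;> simp [rot]
  have hsum2 : ∑ z ∈ S₂, f z = ∑ z ∈ halfAnnulus M u, f z := by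
    rw [← hrot, sum_image (fun x _ y _ h ↦ rot_injective h)]
    refine sum_congr rfl fun z _ ↦ ?_
    rw [hf]; dsimp only; rw [phase_rot]
  rw [hunion, sum_union hd3, sum_union hd12, hsum2]
  ring

/-- The diagonal has at most `2(2⌊√u⌋ + 1)` points. [folklore] -/
theorem card_diagAnnulus_le (M u : ℕ) : ((diagAnnulus M u).card : ℝ) ≤ 2 * (2 * Nat.sqrt u + 1) := by
  classical
  set B : ℕ := Nat.sqrt u with hB
  have hsub : diagAnnulus M u ⊆ (Icc (-(B : ℤ)) B).image (fun k ↦ (⟨k, k⟩ : GaussianInt)) ∪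
      (Icc (-(B : ℤ)) B).image (fun k ↦ (⟨k, -k⟩ : GaussianInt)) := by
    intro z hz
    rw [diagAnnulus, mem_filter] at hz
    obtain ⟨hzS, hdiag⟩ := hz
    have hre := (abs_re_im_le_sqrt hzS).1
    rw [← hB] at hre
    have hreI : z.re ∈ Icc (-(B : ℤ)) B := mem_Icc.mpr (abs_le.mp hre)
    rw [mem_union, mem_image, mem_image]
    rcases abs_eq_abs.mp hdiag.symm with h | h
    · exact Or.inl ⟨z.re, hreI, by ext <;> simp [h]⟩
    · exact Or.inr ⟨z.re, hreI, by ext <;> simp [h]⟩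
  have h1 := card_le_card hsub
  have h2 := (card_union_le _ _).trans' h1
  have hI : (Icc (-(B : ℤ)) B).card = 2 * B + 1 := by
    rw [Int.card_Icc]; omega
  have h3 : ((Icc (-(B : ℤ)) B).image (fun k ↦ (⟨k, k⟩ : GaussianInt))).card ≤ 2 * B + 1 :=
    card_image_le.trans hI.le
  have h4 : ((Icc (-(B : ℤ)) B).image (fun k ↦ (⟨k, -k⟩ : GaussianInt))).card ≤ 2 * B + 1 :=
    card_image_le.trans hI.le
  have : (diagAnnulus M u).card ≤ 2 * (2 * B + 1) := by omega
  exact_mod_cast this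

/-- Trivial bound: `‖∑_{z ∈ s} Φ(z)‖ ≤ #s`. [folklore] -/
theorem norm_sum_phase_le_card (m : ℕ) (t : ℝ) (s : Finset GaussianInt) :
    ‖∑ z ∈ s, angularChar m z * (((z.norm : ℝ)) : ℂ) ^ (-(t * I))‖ ≤ s.card := by
  calc ‖∑ z ∈ s, angularChar m z * (((z.norm : ℝ)) : ℂ) ^ (-(t * I))‖
      ≤ ∑ z ∈ s, ‖angularChar m z * (((z.norm : ℝ)) : ℂ) ^ (-(t * I))‖ := norm_sum_le _ _
    _ ≤ ∑ _z ∈ s, (1 : ℝ) := sum_le_sum fun z _ ↦ norm_phase_le_one m t z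
    _ = s.card := by simp

/-! ### The strict half along the lines `Im z = b` -/

/-- Fibres of `im`: for `S` with `|re z| ≤ B` on `S`,
`∑_{z ∈ S, im z = b} g(z) = ∑_{a ∈ [-B, B], ⟨a, b⟩ ∈ S} g(⟨a, b⟩)`. [folklore] -/
theorem sum_filter_im_eq {S : Finset GaussianInt} {B : ℕ} (hS : ∀ z ∈ S, |z.re| ≤ (B : ℤ))
    (g : GaussianInt → ℂ) (b : ℤ) :
    ∑ z ∈ S.filter (fun z ↦ z.im = b), g z =
      ∑ a ∈ (Icc (-(B : ℤ)) B).filter (fun a ↦ (⟨a, b⟩ : GaussianInt) ∈ S), g ⟨a, b⟩ := by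
  classical
  have himg : ((Icc (-(B : ℤ)) B).filter (fun a ↦ (⟨a, b⟩ : GaussianInt) ∈ S)).image
      (fun a ↦ (⟨a, b⟩ : GaussianInt)) = S.filter (fun z ↦ z.im = b) := by
    ext z
    simp only [mem_image, mem_filter, mem_Icc]
    constructor
    · rintro ⟨a, ⟨-, ha⟩, rfl⟩
      exact ⟨ha, rfl⟩
    · rintro ⟨hz, rfl⟩
      refine ⟨z.re, ⟨abs_le.mp (hS z hz), ?_⟩, ?_⟩
      · convert hz
      · ext <;> rfl
  rw [← himg, sum_image]
  intro x _ y _ h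
  simpa using congrArg Zsqrtd.re h

/-- The per-line factor on the relevant lines: if `M < 2b²` and `b² ≤ 2M` then `½ log(M/2) ≤ log |b|` and
`|b| ≤ √(2M)`, so `C|b|^{1 − log²|b|/(D L²)} ≤ C √(2M) exp(−(½ log(M/2))³/(D L²))`. [folklore] -/
theorem lineFactor_le {C D L : ℝ} (hC : 0 ≤ C) (hD : 0 < D) (hL : 0 < L) {M : ℕ} (hM : 1 ≤ M) {b : ℤ}
    (hb1 : (M : ℝ) < 2 * (b : ℝ) ^ 2) (hb2 : ((b : ℝ)) ^ 2 ≤ 2 * M) :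
    C * |(b : ℝ)| ^ (1 - Real.log |(b : ℝ)| ^ 2 / (D * L ^ 2)) ≤
      C * (Real.sqrt (2 * M) * Real.exp (-((Real.log ((M : ℝ) / 2) / 2) ^ 3 / (D * L ^ 2)))) := by
  have hM1 : (1 : ℝ) ≤ M := by exact_mod_cast hM
  have hbne : b ≠ 0 := by
    rintro rfl
    simp at hb1; linarith
  have hb1' : (1 : ℝ) ≤ |(b : ℝ)| := by
    rw [← Int.cast_abs]; exact_mod_cast Int.one_le_abs hbne
  have hb0 : 0 < |(b : ℝ)| := by linarith
  refine mul_le_mul_of_nonneg_left ?_ hC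
  have hDL : 0 < D * L ^ 2 := by positivity
  -- `|b|^{1-E} = |b| e^{-log³|b|/(DL²)}`
  have hrw : |(b : ℝ)| ^ (1 - Real.log |(b : ℝ)| ^ 2 / (D * L ^ 2)) =
      |(b : ℝ)| * Real.exp (-(Real.log |(b : ℝ)| ^ 3 / (D * L ^ 2))) := by
    rw [Real.rpow_def_of_pos hb0, mul_sub, mul_one, Real.exp_sub, Real.exp_log hb0, Real.exp_neg,
      div_eq_mul_inv]
    have : Real.log |(b : ℝ)| * (Real.log |(b : ℝ)| ^ 2 / (D * L ^ 2)) = Real.log |(b : ℝ)| ^ 3 / (D * L ^ 2) := by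
      ring
    rw [this]
  rw [hrw]
  have hsq : |(b : ℝ)| ≤ Real.sqrt (2 * M) := by
    rw [← Real.sqrt_sq_eq_abs]
    exact Real.sqrt_le_sqrt hb2
  have hlog : Real.log ((M : ℝ) / 2) / 2 ≤ Real.log |(b : ℝ)| := by
    have h1 : Real.log ((M : ℝ) / 2) ≤ Real.log ((b : ℝ) ^ 2) :=
      Real.log_le_log (by positivity) (by linarith)
    have h2 : Real.log ((b : ℝ) ^ 2) = 2 * Real.log |(b : ℝ)| := by
      rw [← Real.log_abs, abs_pow, Real.log_pow]; push_cast; ring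
    linarith
  have hcube : (Real.log ((M : ℝ) / 2) / 2) ^ 3 ≤ Real.log |(b : ℝ)| ^ 3 :=
    (Odd.strictMono_pow (by decide : Odd 3)).monotone hlog
  have hexp : Real.exp (-(Real.log |(b : ℝ)| ^ 3 / (D * L ^ 2))) ≤
      Real.exp (-((Real.log ((M : ℝ) / 2) / 2) ^ 3 / (D * L ^ 2))) := by
    rw [Real.exp_le_exp, neg_le_neg_iff]
    exact div_le_div_of_nonneg_right hcube hDL.le
  exact mul_le_mul hsq hexp (Real.exp_pos _).le (Real.sqrt_nonneg _)

/-- **One line of the strict half.**  The points `⟨a, b⟩` of the strict half with `im = b` and `a ≥ 0`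
(resp. `a < 0`) form an integer interval inside `[-|b|, |b|]`, on a line with `M < 2b²`, `b² ≤ u ≤ 2M`; so by
`LineSumBound` each of the two parts has sum `≤ C|b|^{1 − log²|b|/(D log²V)} ≤ G`. [folklore] -/
theorem norm_sum_line_le {C D : ℝ} (h : LineSumBound C D) {m : ℕ} (hm : 1 ≤ m) (t : ℝ)
    {M u : ℕ} (hu : u ≤ 2 * M) (hMV : (M : ℝ) ≤ ((m : ℝ) + |t| + 3) ^ 4) (B : ℕ) (b : ℤ) {G : ℝ}
    (hG0 : 0 ≤ G)
    (hG : ∀ b : ℤ, (M : ℝ) < 2 * (b : ℝ) ^ 2 → ((b : ℝ)) ^ 2 ≤ 2 * M →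
      C * |(b : ℝ)| ^ (1 - Real.log |(b : ℝ)| ^ 2 / (D * Real.log ((m : ℝ) + |t| + 3) ^ 2)) ≤ G) :
    ‖∑ a ∈ (Icc (-(B : ℤ)) B).filter (fun a ↦ (⟨a, b⟩ : GaussianInt) ∈ halfAnnulus M u),
        angularChar m ⟨a, b⟩ * (((((⟨a, b⟩ : GaussianInt).norm : ℝ)) : ℂ) ^ (-(t * I)))‖ ≤ 2 * G := by
  classical
  set F := (Icc (-(B : ℤ)) B).filter (fun a ↦ (⟨a, b⟩ : GaussianInt) ∈ halfAnnulus M u) with hF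
  set g : ℤ → ℂ := fun a ↦ angularChar m ⟨a, b⟩ * (((((⟨a, b⟩ : GaussianInt).norm : ℝ)) : ℂ) ^ (-(t * I)))
    with hg
  -- membership
  have hmem : ∀ a, a ∈ F ↔
      (-(B : ℤ) ≤ a ∧ a ≤ B) ∧ (a ^ 2 + b ^ 2 ≤ u ∧ (M : ℤ) < a ^ 2 + b ^ 2) ∧ |a| < |b| := by
    intro a
    rw [hF, mem_filter, mem_Icc, mem_halfAnnulus_mk]
  -- a nonempty order-convex part of `F` is a line segment with the right bound
  have hseg : ∀ T : Finset ℤ, T ⊆ F → T.Nonempty →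
      (∀ x ∈ T, ∀ y ∈ T, ∀ z : ℤ, x ≤ z → z ≤ y → z ∈ T) → ‖∑ a ∈ T, g a‖ ≤ G := by
    intro T hTF hTne hTconv
    have hT := eq_Icc_of_ordConnected hTne hTconv
    obtain ⟨-, ⟨hA1u, hA1M⟩, hA1b⟩ := (hmem _).mp (hTF (T.min'_mem hTne))
    obtain ⟨-, -, hA2b⟩ := (hmem _).mp (hTF (T.max'_mem hTne))
    have hbne : b ≠ 0 := by
      rintro rfl
      rw [abs_zero] at hA1b
      exact absurd hA1b (not_lt.mpr (abs_nonneg _))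
    have hsq : T.min' hTne ^ 2 < b ^ 2 := sq_lt_sq.mpr hA1b
    have h2b : (M : ℝ) < 2 * (b : ℝ) ^ 2 := by
      have : (M : ℤ) < 2 * b ^ 2 := by linarith
      exact_mod_cast this
    have hb2u : b ^ 2 ≤ (u : ℤ) := by nlinarith [sq_nonneg (T.min' hTne)]
    have hu' : (u : ℤ) ≤ 2 * M := by exact_mod_cast hu
    have hb2M : ((b : ℝ)) ^ 2 ≤ 2 * M := by
      have : b ^ 2 ≤ 2 * (M : ℤ) := hb2u.trans hu'
      exact_mod_cast this
    have hbV : ((b : ℝ)) ^ 2 ≤ 2 * ((m : ℝ) + |t| + 3) ^ 4 := by linarith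
    have hlo : -|b| ≤ T.min' hTne := by linarith [(abs_lt.mp hA1b).1]
    have hhi : T.max' hTne ≤ |b| := (le_abs_self _).trans hA2b.le
    have hline := h m t b (T.min' hTne) (T.max' hTne) hm hbne hlo hhi hbV
    rw [hT]
    exact hline.trans (hG b h2b hb2M)
  -- split `F` by the sign of `a`
  rw [← sum_filter_add_sum_filter_not F (fun a ↦ 0 ≤ a)]
  have hpos : ‖∑ a ∈ F.filter (fun a ↦ 0 ≤ a), g a‖ ≤ G := by
    rcases (F.filter (fun a ↦ 0 ≤ a)).eq_empty_or_nonempty with he | hne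
    · rw [he, sum_empty, norm_zero]; exact hG0
    refine hseg _ (filter_subset _ _) hne ?_
    intro x hx y hy z hxz hzy
    rw [mem_filter, hmem] at hx hy ⊢
    obtain ⟨⟨⟨hx1, hx2⟩, ⟨hx3, hx4⟩, hx5⟩, hx0⟩ := hx
    obtain ⟨⟨⟨hy1, hy2⟩, ⟨hy3, hy4⟩, hy5⟩, hy0⟩ := hy
    have hz0 : 0 ≤ z := hx0.trans hxz
    have hzx : x ^ 2 ≤ z ^ 2 := by nlinarith
    have hzy' : z ^ 2 ≤ y ^ 2 := by nlinarith
    refine ⟨⟨⟨by omega, by omega⟩, ⟨by linarith, by linarith⟩, ?_⟩, hz0⟩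
    rw [abs_of_nonneg hz0]
    rw [abs_of_nonneg hy0] at hy5
    exact lt_of_le_of_lt hzy hy5
  have hneg : ‖∑ a ∈ F.filter (fun a ↦ ¬0 ≤ a), g a‖ ≤ G := by
    rcases (F.filter (fun a ↦ ¬0 ≤ a)).eq_empty_or_nonempty with he | hne
    · rw [he, sum_empty, norm_zero]; exact hG0
    refine hseg _ (filter_subset _ _) hne ?_
    intro x hx y hy z hxz hzy
    rw [mem_filter, hmem] at hx hy ⊢
    obtain ⟨⟨⟨hx1, hx2⟩, ⟨hx3, hx4⟩, hx5⟩, hx0⟩ := hx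
    obtain ⟨⟨⟨hy1, hy2⟩, ⟨hy3, hy4⟩, hy5⟩, hy0⟩ := hy
    push Not at hx0 hy0
    have hz0 : z < 0 := lt_of_le_of_lt hzy hy0
    have hzx : z ^ 2 ≤ x ^ 2 := by nlinarith
    have hzy' : y ^ 2 ≤ z ^ 2 := by nlinarith
    refine ⟨⟨⟨by omega, by omega⟩, ⟨by linarith, by linarith⟩, ?_⟩, by push Not; exact hz0⟩
    rw [abs_of_neg hz0]
    rw [abs_of_neg hx0] at hx5
    linarith
  calc ‖∑ a ∈ F.filter (fun a ↦ 0 ≤ a), g a + ∑ a ∈ F.filter (fun a ↦ ¬0 ≤ a), g a‖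
      ≤ ‖∑ a ∈ F.filter (fun a ↦ 0 ≤ a), g a‖ + ‖∑ a ∈ F.filter (fun a ↦ ¬0 ≤ a), g a‖ := norm_add_le _ _
    _ ≤ G + G := add_le_add hpos hneg
    _ = 2 * G := by ring

/-- **The strict half**: summing `norm_sum_line_le` over the lines `|b| ≤ ⌊√u⌋`,
`‖∑_{half} Φ‖ ≤ (2⌊√u⌋ + 1) · 2G`. [folklore] -/
theorem norm_sum_halfAnnulus_le {C D : ℝ} (h : LineSumBound C D) {m : ℕ} (hm : 1 ≤ m) (t : ℝ)
    {M u : ℕ} (hu : u ≤ 2 * M) (hMV : (M : ℝ) ≤ ((m : ℝ) + |t| + 3) ^ 4) {G : ℝ} (hG0 : 0 ≤ G)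
    (hG : ∀ b : ℤ, (M : ℝ) < 2 * (b : ℝ) ^ 2 → ((b : ℝ)) ^ 2 ≤ 2 * M →
      C * |(b : ℝ)| ^ (1 - Real.log |(b : ℝ)| ^ 2 / (D * Real.log ((m : ℝ) + |t| + 3) ^ 2)) ≤ G) :
    ‖∑ z ∈ halfAnnulus M u, angularChar m z * (((z.norm : ℝ)) : ℂ) ^ (-(t * I))‖ ≤
      (2 * Nat.sqrt u + 1) * (2 * G) := by
  classical
  set B : ℕ := Nat.sqrt u with hB
  set f : GaussianInt → ℂ := fun z ↦ angularChar m z * (((z.norm : ℝ)) : ℂ) ^ (-(t * I)) with hf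
  have hsub : halfAnnulus M u ⊆ annulus M u := filter_subset _ _
  have hmaps : ∀ z ∈ halfAnnulus M u, z.im ∈ Icc (-(B : ℤ)) B := fun z hz ↦
    mem_Icc.mpr (abs_le.mp (abs_re_im_le_sqrt (hsub hz)).2)
  have hre : ∀ z ∈ halfAnnulus M u, |z.re| ≤ (B : ℤ) := fun z hz ↦ (abs_re_im_le_sqrt (hsub hz)).1
  rw [← sum_fiberwise_of_maps_to hmaps f]
  have hcard : ((Icc (-(B : ℤ)) B).card : ℝ) = 2 * B + 1 := by
    rw [Int.card_Icc]
    have : ((B : ℤ) + 1 - -(B : ℤ)).toNat = 2 * B + 1 := by omega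
    rw [this]; push_cast; ring
  calc ‖∑ b ∈ Icc (-(B : ℤ)) B, ∑ z ∈ (halfAnnulus M u).filter (fun z ↦ z.im = b), f z‖
      ≤ ∑ b ∈ Icc (-(B : ℤ)) B, ‖∑ z ∈ (halfAnnulus M u).filter (fun z ↦ z.im = b), f z‖ := norm_sum_le _ _
    _ ≤ ∑ _b ∈ Icc (-(B : ℤ)) B, 2 * G := by
        refine sum_le_sum fun b _ ↦ ?_
        rw [sum_filter_im_eq hre f b]
        exact norm_sum_line_le h hm t hu hMV B b hG0 hG
    _ = (2 * Nat.sqrt u + 1) * (2 * G) := by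
        rw [sum_const, nsmul_eq_mul, hcard]

/-! ### The lattice bound -/

/-- **Coleman's Theorem 1 for `ℤ[i]` from the line bounds**:
`LineSumBound C D ⟹ LatticeExpSumBound (24C + 54) (max(64D, 32))`.  The annulus `M < N(z) ≤ u` (`u ≤ 2M`) is
twice its strict half `|re z| < |im z|` (rotation `z ↦ iz`, `Φ(iz) = Φ(z)`) plus at most `2(2⌊√u⌋ + 1)` diagonal
points; the strict half is covered by the lines `Im z = b`, `M < 2b²`, `b² ≤ u`, each meeting it in two integer
intervals inside `[-|b|, |b|]`, so it contributes `≤ (2⌊√u⌋ + 1) · 2C √(2M) e^{−(½ log(M/2))³/(D log²V)}`, and for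
`M ≥ 4`, `(½ log(M/2))³ ≥ log³M/64`. [cite: ColemanMathematika1990, Theorem 1] -/
theorem latticeExpSumBound_of_lineSumBound {C D : ℝ} (hC : 0 ≤ C) (hD : 0 < D) (h : LineSumBound C D) :
    ∃ C' D' : ℝ, 0 ≤ C' ∧ 0 < D' ∧ LatticeExpSumBound C' D' := by
  refine ⟨24 * C + 54, max (64 * D) 32, by positivity, lt_max_of_lt_right (by norm_num), ?_⟩
  intro m t M u hm hM hMu hu hMV
  have hm1 : (1 : ℝ) ≤ m := by exact_mod_cast hm
  have hV4 : (4 : ℝ) ≤ (m : ℝ) + |t| + 3 := by linarith [abs_nonneg t]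
  have hL0 : 0 < Real.log ((m : ℝ) + |t| + 3) := Real.log_pos (by linarith)
  have hM1 : (1 : ℝ) ≤ M := by exact_mod_cast hM
  have hM0 : (0 : ℝ) < M := by linarith
  have hD' : (0 : ℝ) < max (64 * D) 32 := lt_max_of_lt_right (by norm_num)
  -- the exponent `E = log²M/(D' log²V) ≤ 1/2`
  set L : ℝ := Real.log ((m : ℝ) + |t| + 3) with hLdef
  set E : ℝ := Real.log M ^ 2 / (max (64 * D) 32 * L ^ 2) with hEdef
  have hlogM : 0 ≤ Real.log M := Real.log_nonneg hM1
  have hlogMV : Real.log M ≤ 4 * L := by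
    have h4 : Real.log (((m : ℝ) + |t| + 3) ^ 4) = 4 * L := by
      rw [Real.log_pow, hLdef]; norm_num
    rw [← h4]; exact Real.log_le_log hM0 hMV
  have hE : E ≤ 1 / 2 := by
    rw [hEdef, div_le_iff₀ (by positivity)]
    have h32 : (32 : ℝ) ≤ max (64 * D) 32 := le_max_right _ _
    have h16 : Real.log M ^ 2 ≤ 16 * L ^ 2 := by nlinarith
    nlinarith [sq_nonneg L]
  have hE0 : 0 ≤ E := by rw [hEdef]; positivity
  -- `M^{1-E} ≥ M^{1/2} ≥ 1`
  have hT1 : (1 : ℝ) ≤ (M : ℝ) ^ (1 - E) := Real.one_le_rpow hM1 (by linarith)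
  have hThalf : (M : ℝ) ^ (1 / 2 : ℝ) ≤ (M : ℝ) ^ (1 - E) := Real.rpow_le_rpow_of_exponent_le hM1 (by linarith)
  rcases lt_or_ge M 4 with hM4 | hM4
  · -- small `M`: the trivial bound `≤ #normLE u ≤ 9u ≤ 54`
    have hu1 : 1 ≤ u := hM.trans hMu
    have hcard : ((annulus M u).card : ℝ) ≤ 54 := by
      have h1 : ((annulus M u).card : ℝ) ≤ (normLE (u : ℝ)).card := by
        exact_mod_cast card_le_card (filter_subset _ _)
      have h2 := GaussianHecke.card_normLE_le_nine_mul hu1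
      have hu6 : (u : ℝ) ≤ 6 := by
        have : u ≤ 6 := by omega
        exact_mod_cast this
      linarith
    rw [latticeBlockSum_eq]
    calc ‖∑ z ∈ annulus M u, angularChar m z * (((z.norm : ℝ)) : ℂ) ^ (-(t * I))‖
        ≤ ((annulus M u).card : ℝ) := norm_sum_phase_le_card m t _
      _ ≤ 54 := hcard
      _ ≤ (24 * C + 54) * 1 := by nlinarith
      _ ≤ (24 * C + 54) * (M : ℝ) ^ (1 - E) := mul_le_mul_of_nonneg_left hT1 (by positivity)
  · -- `M ≥ 4`
    set G : ℝ := C * (Real.sqrt (2 * M) *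
      Real.exp (-((Real.log ((M : ℝ) / 2) / 2) ^ 3 / (D * L ^ 2)))) with hGdef
    have hG0 : 0 ≤ G := by rw [hGdef]; positivity
    have hG : ∀ b : ℤ, (M : ℝ) < 2 * (b : ℝ) ^ 2 → ((b : ℝ)) ^ 2 ≤ 2 * M →
        C * |(b : ℝ)| ^ (1 - Real.log |(b : ℝ)| ^ 2 / (D * L ^ 2)) ≤ G :=
      fun b hb1 hb2 ↦ lineFactor_le hC hD hL0 hM hb1 hb2
    have hhalf := norm_sum_halfAnnulus_le h hm t hu hMV hG0 hG
    have hdiag : ‖∑ z ∈ diagAnnulus M u, angularChar m z * (((z.norm : ℝ)) : ℂ) ^ (-(t * I))‖ ≤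
        2 * (2 * Nat.sqrt u + 1) :=
      (norm_sum_phase_le_card m t _).trans (card_diagAnnulus_le M u)
    -- `2⌊√u⌋ + 1 ≤ 3 √(2M)` and `√(2M) ≤ (3/2) √M`
    have hB : (Nat.sqrt u : ℝ) ≤ Real.sqrt (2 * M) := by
      have h1 : ((Nat.sqrt u : ℕ) : ℝ) ^ 2 ≤ u := by exact_mod_cast Nat.sqrt_le' u
      have h2 : (u : ℝ) ≤ 2 * M := by exact_mod_cast hu
      calc (Nat.sqrt u : ℝ) = Real.sqrt (((Nat.sqrt u : ℕ) : ℝ) ^ 2) := by rw [Real.sqrt_sq (by positivity)]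
        _ ≤ Real.sqrt (2 * M) := Real.sqrt_le_sqrt (by linarith)
    have hsqrt1 : (1 : ℝ) ≤ Real.sqrt (2 * M) := Real.one_le_sqrt.mpr (by linarith)
    have hB3 : (2 * Nat.sqrt u + 1 : ℝ) ≤ 3 * Real.sqrt (2 * M) := by linarith
    have hsq2 : Real.sqrt (2 * M) * Real.sqrt (2 * M) = 2 * M := Real.mul_self_sqrt (by positivity)
    have hsqrtM : Real.sqrt (2 * M) ≤ 3 / 2 * Real.sqrt M := by
      rw [Real.sqrt_mul (by norm_num) (M : ℝ)]
      have : Real.sqrt 2 ≤ 3 / 2 := by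
        rw [show (3 / 2 : ℝ) = Real.sqrt ((3 / 2) ^ 2) by rw [Real.sqrt_sq (by norm_num)]]
        exact Real.sqrt_le_sqrt (by norm_num)
      exact mul_le_mul_of_nonneg_right this (Real.sqrt_nonneg _)
    have hsqrt_rpow : Real.sqrt M = (M : ℝ) ^ (1 / 2 : ℝ) := Real.sqrt_eq_rpow (M : ℝ)
    -- the exponential: for `M ≥ 4`, `(log(M/2)/2)³ ≥ log³M/64`, so `EXP ≤ M^{-E}`
    have hM4' : (4 : ℝ) ≤ M := by exact_mod_cast hM4
    have hlog2 : Real.log 2 ≤ Real.log M / 2 := by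
      have : Real.log 4 ≤ Real.log M := Real.log_le_log (by norm_num) hM4'
      have h4 : Real.log 4 = 2 * Real.log 2 := by
        rw [show (4 : ℝ) = 2 ^ 2 by norm_num, Real.log_pow]; push_cast; ring
      linarith
    have hlogM2 : Real.log M / 4 ≤ Real.log ((M : ℝ) / 2) / 2 := by
      rw [Real.log_div hM0.ne' (by norm_num)]; linarith
    have hcube : (Real.log M / 4) ^ 3 ≤ (Real.log ((M : ℝ) / 2) / 2) ^ 3 :=
      pow_le_pow_left₀ (by positivity) hlogM2 3
    have hexp : Real.exp (-((Real.log ((M : ℝ) / 2) / 2) ^ 3 / (D * L ^ 2))) ≤ (M : ℝ) ^ (-E) := by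
      rw [Real.rpow_def_of_pos hM0, Real.exp_le_exp, hEdef]
      have hDD : 64 * D ≤ max (64 * D) 32 := le_max_left _ _
      have h1 : Real.log M * (Real.log M ^ 2 / (max (64 * D) 32 * L ^ 2)) ≤ (Real.log M / 4) ^ 3 / (D * L ^ 2) := by
        rw [show Real.log M * (Real.log M ^ 2 / (max (64 * D) 32 * L ^ 2)) =
            Real.log M ^ 3 / (max (64 * D) 32 * L ^ 2) by ring,
          show (Real.log M / 4) ^ 3 / (D * L ^ 2) = Real.log M ^ 3 / (64 * D * L ^ 2) by ring]
        exact div_le_div_of_nonneg_left (by positivity) (by positivity) (by nlinarith [sq_nonneg L])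
      have h2 : (Real.log M / 4) ^ 3 / (D * L ^ 2) ≤ (Real.log ((M : ℝ) / 2) / 2) ^ 3 / (D * L ^ 2) :=
        div_le_div_of_nonneg_right hcube (by positivity)
      have h3 : Real.log M * -(Real.log M ^ 2 / (max (64 * D) 32 * L ^ 2)) =
          -(Real.log M * (Real.log M ^ 2 / (max (64 * D) 32 * L ^ 2))) := by ring
      rw [h3]
      linarith
    have hsplit : (M : ℝ) ^ (1 - E) = M * (M : ℝ) ^ (-E) := by
      rw [sub_eq_add_neg, Real.rpow_add hM0, Real.rpow_one]
    -- assemble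
    rw [latticeBlockSum_eq, sum_annulus_eq]
    have h2norm : ‖(2 : ℂ)‖ = 2 := by norm_num
    calc ‖2 * ∑ z ∈ halfAnnulus M u, angularChar m z * (((z.norm : ℝ)) : ℂ) ^ (-(t * I)) +
          ∑ z ∈ diagAnnulus M u, angularChar m z * (((z.norm : ℝ)) : ℂ) ^ (-(t * I))‖
        ≤ ‖2 * ∑ z ∈ halfAnnulus M u, angularChar m z * (((z.norm : ℝ)) : ℂ) ^ (-(t * I))‖ +
          ‖∑ z ∈ diagAnnulus M u, angularChar m z * (((z.norm : ℝ)) : ℂ) ^ (-(t * I))‖ := norm_add_le _ _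
      _ ≤ 2 * ((2 * Nat.sqrt u + 1) * (2 * G)) + 2 * (2 * Nat.sqrt u + 1) := by
          rw [norm_mul, h2norm]
          exact add_le_add (mul_le_mul_of_nonneg_left hhalf (by norm_num)) hdiag
      _ ≤ 2 * ((3 * Real.sqrt (2 * M)) * (2 * G)) + 2 * (3 * Real.sqrt (2 * M)) := by
          have := mul_le_mul_of_nonneg_right hB3 (by positivity : (0 : ℝ) ≤ 2 * G)
          nlinarith
      _ = 24 * C * M * Real.exp (-((Real.log ((M : ℝ) / 2) / 2) ^ 3 / (D * L ^ 2))) + 6 * Real.sqrt (2 * M) := by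
          rw [hGdef]
          have : 2 * ((3 * Real.sqrt (2 * M)) * (2 * (C * (Real.sqrt (2 * M) *
              Real.exp (-((Real.log ((M : ℝ) / 2) / 2) ^ 3 / (D * L ^ 2))))))) =
              12 * C * (Real.sqrt (2 * M) * Real.sqrt (2 * M)) *
                Real.exp (-((Real.log ((M : ℝ) / 2) / 2) ^ 3 / (D * L ^ 2))) := by ring
          rw [this, hsq2]; ring
      _ ≤ 24 * C * M * (M : ℝ) ^ (-E) + 9 * (M : ℝ) ^ (1 / 2 : ℝ) := by
          refine add_le_add (mul_le_mul_of_nonneg_left hexp (by positivity)) ?_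
          rw [← hsqrt_rpow]; linarith
      _ ≤ 24 * C * (M : ℝ) ^ (1 - E) + 54 * (M : ℝ) ^ (1 - E) := by
          have h24 : 24 * C * M * (M : ℝ) ^ (-E) = 24 * C * (M : ℝ) ^ (1 - E) := by
            rw [hsplit]; ring
          have h9 : 9 * (M : ℝ) ^ (1 / 2 : ℝ) ≤ 54 * (M : ℝ) ^ (1 - E) := by linarith
          linarith
      _ = (24 * C + 54) * (M : ℝ) ^ (1 - E) := by ring

/-! ### Consequences: Coleman's zero-free region and Harman's Lemma 11.6 from the line bounds -/

/-- **Coleman's zero-free region for `L(s, λ^m)` over `ℚ(i)` from the line bounds**: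
`LineSumBound C D → ∃ c > 0, HasVKZeroFreeRegion c 21`. [cite: ColemanMathematika1990, Theorem 2] -/
theorem exists_hasVKZeroFreeRegion_of_lineSumBound {C D : ℝ} (hC : 0 ≤ C) (hD : 0 < D) (h : LineSumBound C D) :
    ∃ c : ℝ, 0 < c ∧ GaussianHecke.HasVKZeroFreeRegion c 21 := by
  obtain ⟨C', D', hC', hD', hL⟩ := latticeExpSumBound_of_lineSumBound hC hD h
  exact GaussianHecke.exists_hasVKZeroFreeRegion_of_latticeExpSumBound hL hC' hD'

/-- **Harman's Lemma 11.6 from the line bounds**: `LineSumBound C D → GaussianInt.harman_primeCharSum_bound`.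
[cite: Harman2007, Lemma 11.6] -/
theorem harman_primeCharSum_bound_of_lineSumBound {C D : ℝ} (hC : 0 ≤ C) (hD : 0 < D) (h : LineSumBound C D) :
    GaussianInt.harman_primeCharSum_bound := by
  obtain ⟨c, hc, hVK⟩ := exists_hasVKZeroFreeRegion_of_lineSumBound hC hD h
  exact GaussianInt.harman_primeCharSum_bound_of_vk hc hVK

end GaussLine

end Literature.NumberTheory.LFunctions
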